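import Summits.Langlands.Langlands.Theorems.IrreducibilityBySelfDualityPairLBoundaryJSCornerGlobal

/-!
# The generic character along the corner `GL_m ↪ GL_n` at general corank: `ψ_{N_n}(diag(u, 1_{n-m})) = ψ_{N_m}(u)`
# and the `(N_m(𝔸), ψ)`-equivariance of `x ↦ W_Φ(diag(x, 1_{n-m}))`

Summit `Langlands`, sub-problem `Langlands`, helper file under `Theorems/` supporting the crux `PairLBoundaryJS`
(stmt-Langlands-13622), line `Sketch`, wave 3 (projector road, lead c6), registered sub-stub
`stub_gap_proj_corner_char`: the general-corank versions of the three corner lemmas of `CornerGlobal`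
(`superdiagSumFrom_one_glCorner`, `glCorner_mem_adelicColRange`, `whittakerDepth_zero_glCorner_colRange_mul`,
stated there for `glCorner (Nat.le_succ m)`), for the assembly of the projected global theorem (`GapProjectedGlobal`):
for `m ≤ n`, the superdiagonal sum of `diag(u, 1_{n-m})` from the column `1` is that of `u` (the extra entries
`(m-1, m)` and `(i, i+1)`, `i ≥ m`, vanish), so the generic character restricts along the corner, the corner maps
`N_m(𝔸_K)` into `N_n(𝔸_K)`, and `W_Φ(diag(u x, 1)) = ψ_N(u) W_Φ(diag(x, 1))` for `Φ` left `GL_n(K)`-invariant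
(Cogdell (2004), §1.1, §2.2). [cite: CogdellAnalyticTheory2004, §1.1 and §2.2]

## References

* J. W. Cogdell, *Analytic theory of L-functions for GL_n* (2004), §1.1, §2.2 [CogdellAnalyticTheory2004].
-/

noncomputable section

-- `Summit.Langlands.Langlands.…` (summit = sub-problem name, D-0017 layout) trips `dupNamespace`
set_option linter.dupNamespace false

open scoped MatrixGroups ComplexConjugate
open NumberField IsDedekindDomain MeasureTheory Matrix Set
open Literature.NumberTheory.Automorphic

-- the house local instances (Borel structures of `GL_n(𝔸_K)` and `𝔸_Kˣ`), exactly as in the sibling Gap* files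
attribute [local instance] adelicBorel borelSpace_adelic locallyCompactSpace_adelic secondCountableTopology_gl_adelic
  glAdeleBorel borelSpace_glAdele borelSpace_ideleGroup secondCountableTopology_ideleGroup

namespace Summit.Langlands.Langlands.Theorems.GapProjectedCornerChar

section Corner

variable {n m : ℕ} {K : Type} [Field K] [NumberField K]

/-- **The superdiagonal sum from the column `1` of the corner `diag(u, 1_{n-m}) ∈ GL_n` is that of `u`** (the
extra entries `(m-1, m)` and `(i, i+1)`, `i ≥ m`, of `diag(u, 1)` vanish). [folklore] -/
theorem superdiagSumFrom_one_glCorner {R : Type*} [CommRing R] (hmn : m ≤ n) (u : GL (Fin m) R) :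
    superdiagSumFrom 1 ((glCorner R hmn u : GL (Fin n) R) : Matrix (Fin n) (Fin n) R) =
      superdiagSumFrom 1 (u : Matrix (Fin m) (Fin m) R) := by
  classical
  unfold superdiagSumFrom
  -- both sides are the sum over `ℕ` of the same finitely supported function
  set f : ℕ → R := fun j => if h : 1 ≤ j ∧ j < m then (u : Matrix (Fin m) (Fin m) R) ⟨j - 1, by omega⟩ ⟨j, h.2⟩ else 0
    with hf
  have hL : ∀ j : Fin n, (if h : 1 ≤ (j : ℕ) ∧ 0 < (j : ℕ) then
      ((glCorner R hmn u : GL (Fin n) R) : Matrix (Fin n) (Fin n) R) ⟨(j : ℕ) - 1, by have := j.2; omega⟩ j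
      else 0) = f j := by
    intro j
    by_cases hj1 : 1 ≤ (j : ℕ) ∧ 0 < (j : ℕ)
    · rw [dif_pos hj1]
      simp only [hf]
      rw [glCorner_apply_val]
      by_cases hjm : (j : ℕ) < m
      · have hi : (j : ℕ) - 1 < m := by omega
        rw [dif_pos (show ((⟨(j : ℕ) - 1, _⟩ : Fin n) : ℕ) < m from hi), dif_pos hjm, dif_pos ⟨hj1.1, hjm⟩]
      · rw [dif_neg (fun h : 1 ≤ (j : ℕ) ∧ (j : ℕ) < m => hjm h.2)]
        by_cases hi : (j : ℕ) - 1 < m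
        · rw [dif_pos (show ((⟨(j : ℕ) - 1, _⟩ : Fin n) : ℕ) < m from hi), dif_neg hjm]
        · rw [dif_neg (show ¬ ((⟨(j : ℕ) - 1, _⟩ : Fin n) : ℕ) < m from hi), if_neg hjm]
          have hne : (⟨(j : ℕ) - 1, by have := j.2; omega⟩ : Fin n) ≠ j := fun h => by
            have h' := congrArg Fin.val h
            simp only at h'
            omega
          rw [if_neg hne]
    · rw [dif_neg hj1]
      simp only [hf]
      rw [dif_neg (fun h : 1 ≤ (j : ℕ) ∧ (j : ℕ) < m => hj1 ⟨h.1, h.1⟩)]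
  have hR : ∀ j : Fin m, (if h : 1 ≤ (j : ℕ) ∧ 0 < (j : ℕ) then
      (u : Matrix (Fin m) (Fin m) R) ⟨(j : ℕ) - 1, by have := j.2; omega⟩ j else 0) = f j := by
    intro j
    by_cases hj1 : 1 ≤ (j : ℕ) ∧ 0 < (j : ℕ)
    · rw [dif_pos hj1]
      simp only [hf]
      rw [dif_pos ⟨hj1.1, j.2⟩]
    · rw [dif_neg hj1]
      simp only [hf]
      rw [dif_neg (fun h : 1 ≤ (j : ℕ) ∧ (j : ℕ) < m => hj1 ⟨h.1, h.1⟩)]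
  rw [Finset.sum_congr rfl (fun j _ => hL j), Finset.sum_congr rfl (fun j _ => hR j),
    Fin.sum_univ_eq_sum_range (fun j => f j) n, Fin.sum_univ_eq_sum_range (fun j => f j) m,
    ← Finset.sum_range_add_sum_Ico f hmn, Finset.sum_eq_zero (s := Finset.Ico m n) (fun j hj => ?_), add_zero]
  simp only [hf]
  rw [dif_neg]
  exact fun h => absurd h.2 (not_lt.2 (Finset.mem_Ico.1 hj).1)

/-- **`ψ_{N_n}(diag(u, 1_{n-m})) = ψ_{N_m}(u)`**: the generic character restricts along the corner. [folklore] -/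
theorem unipotentCharFrom_one_glCorner (hmn : m ≤ n) (u : GL (Fin m) (AdeleRing (𝓞 K) K)) :
    unipotentCharFrom (K := K) 1 (glCorner (AdeleRing (𝓞 K) K) hmn u) = unipotentCharFrom (K := K) 1 u := by
  rw [unipotentCharFrom_apply, unipotentCharFrom_apply, superdiagSumFrom_one_glCorner]

/-- **The corner maps `N_m(𝔸_K)` into `N_n(𝔸_K)`** (`m ≤ n`). [folklore] -/
theorem glCorner_mem_adelicColRange (hmn : m ≤ n) {u : GL (Fin m) (AdeleRing (𝓞 K) K)}
    (hu : u ∈ adelicColRange m K 1 (m - 1)) :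
    glCorner (AdeleRing (𝓞 K) K) hmn u ∈ adelicColRange n K 1 (n - 1) := by
  have hu' : u ∈ upperUnitriangular (Fin m) (AdeleRing (𝓞 K) K) := by
    rwa [← unipotentColRange_one_eq_upperUnitriangular]
  have h := glCorner_mem_upperUnitriangular hmn hu'
  rwa [← unipotentColRange_one_eq_upperUnitriangular] at h

/-- **`(N_m(𝔸_K), ψ)`-equivariance of `x ↦ W_Φ(diag(x, 1_{n-m}))`** (Cogdell (2004), §1.1, §2.2): for `Φ` on
`GL_n(𝔸_K)` left `GL_n(K)`-invariant, `0 < n`, `u ∈ N_m(𝔸_K)` and `x ∈ GL_m(𝔸_K)`,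
`W_Φ(diag(u x, 1)) = ψ_N(u) W_Φ(diag(x, 1))` (`W_Φ = whittakerDepth 0 Φ`). [cite: CogdellAnalyticTheory2004, §1.1] -/
theorem whittakerDepth_zero_glCorner_colRange_mul (hmn : m ≤ n) (hn : 0 < n)
    {Φ : GL (Fin n) (AdeleRing (𝓞 K) K) → ℂ}
    (hΦK : ∀ (γ₀ : GL (Fin n) K) (x : GL (Fin n) (AdeleRing (𝓞 K) K)), Φ (ratGL K γ₀ * x) = Φ x)
    {u : GL (Fin m) (AdeleRing (𝓞 K) K)} (hu : u ∈ adelicColRange m K 1 (m - 1)) (x : GL (Fin m) (AdeleRing (𝓞 K) K)) :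
    whittakerDepth 0 Φ (glCorner (AdeleRing (𝓞 K) K) hmn (u * x)) =
      (unipotentCharFrom (K := K) 1 u : ℂ) * whittakerDepth 0 Φ (glCorner (AdeleRing (𝓞 K) K) hmn x) := by
  rw [map_mul, whittakerDepth_colRange_mul hΦK hn (by simpa only [zero_add] using glCorner_mem_adelicColRange hmn hu),
    unipotentCharFrom_one_glCorner]

end Corner

/-! ### The registered sub-stub -/

/-- **SUB-STUB (projector road) — the generic character along the corner at general corank**: (i) the corner maps
`N_m(𝔸_K)` into `N_n(𝔸_K)`; (ii) `ψ_{N_n}(diag(u, 1)) = ψ_{N_m}(u)`; (iii) `W_Φ(diag(u x, 1)) = ψ_N(u) W_Φ(diag(x, 1))`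
for `Φ` left `GL_n(K)`-invariant. [cite: CogdellAnalyticTheory2004, §1.1 and §2.2] -/
theorem stub_gap_proj_corner_char :
    ∀ {n m : ℕ} {K : Type} [Field K] [NumberField K] (hmn : m ≤ n) (hn : 0 < n),
    (∀ {u : GL (Fin m) (AdeleRing (𝓞 K) K)}, u ∈ adelicColRange m K 1 (m - 1) →
      glCorner (AdeleRing (𝓞 K) K) hmn u ∈ adelicColRange n K 1 (n - 1)) ∧
    (∀ u : GL (Fin m) (AdeleRing (𝓞 K) K),
      unipotentCharFrom (K := K) 1 (glCorner (AdeleRing (𝓞 K) K) hmn u) = unipotentCharFrom (K := K) 1 u) ∧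
    (∀ {Φ : GL (Fin n) (AdeleRing (𝓞 K) K) → ℂ},
      (∀ (γ₀ : GL (Fin n) K) (x : GL (Fin n) (AdeleRing (𝓞 K) K)), Φ (ratGL K γ₀ * x) = Φ x) →
      ∀ {u : GL (Fin m) (AdeleRing (𝓞 K) K)}, u ∈ adelicColRange m K 1 (m - 1) →
      ∀ x : GL (Fin m) (AdeleRing (𝓞 K) K),
        whittakerDepth 0 Φ (glCorner (AdeleRing (𝓞 K) K) hmn (u * x)) =
          (unipotentCharFrom (K := K) 1 u : ℂ) * whittakerDepth 0 Φ (glCorner (AdeleRing (𝓞 K) K) hmn x)) := by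
  intro n m K _ _ hmn hn
  exact ⟨fun hu => glCorner_mem_adelicColRange hmn hu, fun u => unipotentCharFrom_one_glCorner hmn u,
    fun hΦK _ hu x => whittakerDepth_zero_glCorner_colRange_mul hmn hn hΦK hu x⟩

end Summit.Langlands.Langlands.Theorems.GapProjectedCornerChar

end
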